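import Mathlib
import HarnessLib

/-!
# Hypergeometric groups: Levelt's rigidity theorem and the irreducibility criterion (Beukers–Heckman 1989, §3)

Topic `Literature/AlgebraicGeometry/Motives` (requested there by route
`Summit.HodgeConjecture.HodgeConjecture.Theses.KatzUnwinding`, item `HypergeometricComparison`: the
monodromy of an irreducible local system on `ℙ¹ ∖ {0,1,∞}` whose local monodromy at one puncture
is a pseudo-reflection is hypergeometric, hence RIGID).  Pure linear algebra over `ℂ`.

Primary source: F. Beukers, G. Heckman, *Monodromy for the hypergeometric function `ₙF_{n-1}`*,
Invent. Math. 95 (1989) 325–354 [BeukersHeckman1989], §3: Def. 3.1 (hypergeometric group with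
numerator parameters `a₁,…,aₙ` and denominator parameters `b₁,…,bₙ ∈ ℂ*`: a subgroup of `GL(n, ℂ)`
generated by `h_∞, h₀, h₁` with `h_∞ h₁ h₀ = 1`, `det(t - h_∞) = ∏ (t - a_j)`,
`det(t - h₀⁻¹) = ∏ (t - b_j)` and `h₁` a pseudo-reflection, i.e. `rank(h₁ - 1) = 1`), Prop. 3.3
(irreducibility) and Thm. 3.5 (Levelt 1961: existence and uniqueness up to conjugation).  The
primary text is paywalled (acquisition request acq-02436); the statements below are formalised from
two held secondary sources that restate them, and cite both (reconstruction protocol):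

* S. Singh, *Orthogonal hypergeometric groups with a maximally unipotent monodromy*, Exp. Math.
  (2015), arXiv:1406.5861, p. 3, verbatim: "The hypergeometric groups `ρ(π₁)` are classified by a
  theorem of Levelt ([Le]; cf. [BH]): if `α₁,…,αₙ, β₁,…,βₙ ∈ ℂ` such that `α_j - β_k ∉ ℤ`, for all
  `j,k = 1,2,…,n`, then the hypergeometric group `ρ(π₁)` is (up to conjugation in `GLₙ(ℂ)`) a
  subgroup of `GLₙ(ℂ)` generated by the companion matrices `A` and `B` of
  `f(X) = ∏_{j=1}^n (X - e^{2πiα_j})` and `g(X) = ∏_{j=1}^n (X - e^{2πiβ_j})` resp., and the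
  monodromy `ρ` is defined by `h_∞ ↦ A`, `h₀ ↦ B⁻¹`, `h₁ ↦ A⁻¹B`. […] Note that the condition
  "`α_j - β_k ∉ ℤ`, for all `j,k`" means that `f, g` do not have any common root in `ℂ`."
* R. Fedorov, *Variations of Hodge structures for hypergeometric differential operators and
  parabolic Higgs bundles*, IMRN (2018), arXiv:1505.01704, p. 4: Prop. 2.1–2.2 ("Combine Prop. 3.2
  and Theorem 3.5 of [BeukersHeckman]"; "Combine Prop. 3.2 and Prop. 3.3 of [BeukersHeckman]":
  the hypergeometric local system with `α_j - β_k ∉ ℤ` is irreducible) and Prop. 2.4 (any bundle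
  with connection on `ℙ¹ ∖ {0,1,∞}` with the same local monodromies is isomorphic to it: "This is
  Theorem 3.5 of [BeukersHeckman]").

## The linear algebra (matrix form; `a_j = e^{2πiα_j}`, `b_k = e^{2πiβ_k}`)

With `A = h_∞`, `B = h₀⁻¹` the relation `h_∞ h₁ h₀ = 1` reads `h₁ = A⁻¹ B`, and `h₁` is a
pseudo-reflection iff `rank(A - B) = 1` (`rank(A⁻¹B - 1) = rank(A⁻¹(B - A)) = rank(A - B)`,
`rank_inv_mul_sub_one`).  So a hypergeometric group with parameters `(a; b)` is the same as a
**hypergeometric pair** `(A, B)` of invertible matrices with `det(X - A) = ∏ (X - a_j)`,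
`det(X - B) = ∏ (X - b_k)` and `rank(A - B) = 1` (`IsHypergeometricPair a b A B`), the group being
`⟨A, B⟩ = ⟨h_∞, h₀, h₁⟩`.

* `BeukersHeckman1989_levelt` — NAMED FACT (Thm. 3.5, Levelt): if all `a_j, b_k` are non-zero and
  `a_j ≠ b_k` for all `j, k`, a hypergeometric pair with parameters `(a; b)` EXISTS (the companion
  matrices of `f` and `g`, which differ only in their last column) and any two hypergeometric pairs
  with parameters `(a; b)` are SIMULTANEOUSLY CONJUGATE in `GL(n, ℂ)` — "hypergeometric groups are
  (physically) rigid".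
* `BeukersHeckman1989_irreducible` — named fact (Prop. 3.3 with Prop. 3.2, the direction every
  secondary source quotes), DISCHARGED in this file (`BeukersHeckman1989_irreducible_holds`, proved
  from Mathlib): if moreover `a_j ≠ b_k` for all `j, k`, the group `⟨A, B⟩` acts irreducibly on
  `ℂⁿ`: the only subspaces stable under `A` and `B` are `0` and `ℂⁿ`.  (The converse — a common
  parameter forces reducibility — is classical but not vendored here.)
* API (proved): `IsHypergeometricPair.conj` (the notion is conjugation-invariant, so "unique up to
  conjugation" is the right uniqueness), `rank_inv_mul_sub_one` (pseudo-reflection ⇔ rank-one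
  difference), unfolding lemma, and the eigenvalue-descent lemma `hasEigenvalue_of_sub_smul_mem`.

Statement only for Levelt's theorem (D-0014): its printed proof (one page: for
`v ∈ ⋂_{i ≤ n-2} A^{-i} ker(A - B)` the vectors `v, Av, …, A^{n-1}v` form a basis in which `A, B` are
the companion matrices, a proper span giving a common eigenvalue) is ~300 Lean lines and is left to
a discharge seat; `n = 0` is excluded (`0 < n`), as no rank-one matrix exists there.

## References

* [BeukersHeckman1989] F. Beukers, G. Heckman, Invent. Math. 95 (1989), Def. 3.1, Prop. 3.2,
  Prop. 3.3, Thm. 3.5 (A. H. M. Levelt, *Hypergeometric functions*, thesis, Amsterdam 1961, Thm. 1.1).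
* [Singh2015] S. Singh, arXiv:1406.5861, p. 3 (statement of Levelt's theorem).
* [Fedorov2017] R. Fedorov, arXiv:1505.01704, Prop. 2.1, 2.2, 2.4.
* [Katz1996] N. M. Katz, *Rigid Local Systems*, Thm. 3.5.4 (hypergeometrics are rigid; not used here).
-/

namespace Literature.AlgebraicGeometry.Motives

open Polynomial Matrix

section HypergeometricPair

variable {n : ℕ}

/-- `IsHypergeometricPair a b A B`: the invertible complex matrices `A = h_∞` and `B = h₀⁻¹` generate
a **hypergeometric group with numerator parameters `a` and denominator parameters `b`**
(Beukers–Heckman 1989, Def. 3.1, in matrix form): `det(X - A) = ∏_j (X - a_j)`,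
`det(X - B) = ∏_k (X - b_k)`, and `h₁ = A⁻¹B` is a pseudo-reflection, i.e. `rank(A - B) = 1`
(equivalent formulation, `rank_inv_mul_sub_one`).  Invertibility of `A, B` is recorded explicitly
(it follows from `a_j, b_k ≠ 0`). [cite: BeukersHeckman1989, Def. 3.1]
[cite: Singh2015, p. 3] -/
def IsHypergeometricPair (a b : Fin n → ℂ) (A B : Matrix (Fin n) (Fin n) ℂ) : Prop :=
  IsUnit A.det ∧ IsUnit B.det ∧
    A.charpoly = ∏ j, (X - C (a j)) ∧ B.charpoly = ∏ k, (X - C (b k)) ∧ (A - B).rank = 1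

/-- Unfolding of `IsHypergeometricPair` (by `Iff.rfl`). [cite: BeukersHeckman1989, Def. 3.1] -/
theorem isHypergeometricPair_iff (a b : Fin n → ℂ) (A B : Matrix (Fin n) (Fin n) ℂ) :
    IsHypergeometricPair a b A B ↔
      IsUnit A.det ∧ IsUnit B.det ∧
        A.charpoly = ∏ j, (X - C (a j)) ∧ B.charpoly = ∏ k, (X - C (b k)) ∧ (A - B).rank = 1 :=
  Iff.rfl

/-- **Pseudo-reflection ⇔ rank-one difference**: for invertible `A`,
`rank(A⁻¹B - 1) = rank(A - B)` (as `A⁻¹B - 1 = A⁻¹(B - A)` and `rank(-M) = rank M`), so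
"`h₁ = h_∞⁻¹h₀⁻¹` is a pseudo-reflection" is the rank condition of `IsHypergeometricPair`.
[cite: BeukersHeckman1989, Def. 3.1 and Thm. 3.5] -/
theorem rank_inv_mul_sub_one {A : Matrix (Fin n) (Fin n) ℂ} (hA : IsUnit A.det)
    (B : Matrix (Fin n) (Fin n) ℂ) : (A⁻¹ * B - 1).rank = (A - B).rank := by
  have h1 : A⁻¹ * B - 1 = A⁻¹ * (B - A) := by
    rw [Matrix.mul_sub, Matrix.nonsing_inv_mul _ hA]
  have hAinv : IsUnit A⁻¹.det := Matrix.isUnit_nonsing_inv_det A hA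
  have hneg : IsUnit (-1 : Matrix (Fin n) (Fin n) ℂ).det :=
    (Matrix.isUnit_iff_isUnit_det _).1 isUnit_one.neg
  rw [h1, Matrix.rank_mul_eq_right_of_isUnit_det _ _ hAinv, ← neg_sub, ← neg_one_mul (A - B),
    Matrix.rank_mul_eq_right_of_isUnit_det _ _ hneg]

/-- Hypergeometric pairs with given parameters are stable under simultaneous conjugation by
`P ∈ GL(n, ℂ)` (characteristic polynomials and the rank of `A - B` are conjugation invariants), so
uniqueness in Levelt's theorem can only hold up to conjugation.
[cite: BeukersHeckman1989, Thm. 3.5] -/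
theorem IsHypergeometricPair.conj {a b : Fin n → ℂ} {A B : Matrix (Fin n) (Fin n) ℂ}
    (h : IsHypergeometricPair a b A B) (P : (Matrix (Fin n) (Fin n) ℂ)ˣ) :
    IsHypergeometricPair a b (P.val * A * P.val⁻¹) (P.val * B * P.val⁻¹) := by
  obtain ⟨hA, hB, hcA, hcB, hr⟩ := h
  have hP : IsUnit (P.val).det := (Matrix.isUnit_iff_isUnit_det _).1 P.isUnit
  have hPinv : IsUnit (P.val⁻¹).det := by
    rw [← Matrix.coe_units_inv]
    exact (Matrix.isUnit_iff_isUnit_det _).1 (P⁻¹).isUnit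
  refine ⟨?_, ?_, by rw [Matrix.charpoly_units_conj, hcA], by rw [Matrix.charpoly_units_conj, hcB], ?_⟩
  · rw [Matrix.det_mul, Matrix.det_mul]
    exact (hP.mul hA).mul hPinv
  · rw [Matrix.det_mul, Matrix.det_mul]
    exact (hP.mul hB).mul hPinv
  · have : P.val * A * P.val⁻¹ - P.val * B * P.val⁻¹ = P.val * (A - B) * P.val⁻¹ := by
      rw [Matrix.mul_sub, Matrix.sub_mul]
    rw [this, Matrix.rank_mul_eq_left_of_isUnit_det _ _ hPinv,
      Matrix.rank_mul_eq_right_of_isUnit_det _ _ hP, hr]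

/-- **Levelt's theorem (Beukers–Heckman 1989, Thm. 3.5): hypergeometric groups exist and are rigid.**
For `n ≥ 1` and parameters `a₁,…,aₙ, b₁,…,bₙ ∈ ℂ*` with `a_j ≠ b_k` for all `j, k` ("`f, g` have no
common root"): (existence) there is a hypergeometric pair `(A, B)` with parameters `(a; b)` — in
print the companion matrices of `f = ∏ (X - a_j)` and `g = ∏ (X - b_k)`; (uniqueness) any two
hypergeometric pairs `(A, B)`, `(A', B')` with parameters `(a; b)` are simultaneously conjugate:
`A' = PAP⁻¹`, `B' = PBP⁻¹` for some `P ∈ GL(n, ℂ)`.  Equivalently: up to conjugation there is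
exactly one hypergeometric group with these parameters, generated by `h_∞ = A`, `h₀ = B⁻¹`,
`h₁ = A⁻¹B`.  Statement only (printed proof: Krylov basis `v, Av, …, Aⁿ⁻¹v` for
`v ∈ ⋂_{i≤n-2} A^{-i} ker(A - B)`).  Primary source paywalled; statement as restated in Singh,
arXiv:1406.5861, p. 3, and Fedorov, arXiv:1505.01704, Prop. 2.1 and 2.4.
[cite: BeukersHeckman1989, Thm. 3.5] [cite: Singh2015, p. 3]
[cite: Fedorov2017, Prop. 2.4] -/
def BeukersHeckman1989_levelt : Prop :=
  ∀ ⦃n : ℕ⦄, 0 < n → ∀ (a b : Fin n → ℂ), (∀ j, a j ≠ 0) → (∀ k, b k ≠ 0) →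
    (∀ j k, a j ≠ b k) →
      (∃ A B : Matrix (Fin n) (Fin n) ℂ, IsHypergeometricPair a b A B) ∧
      ∀ (A B A' B' : Matrix (Fin n) (Fin n) ℂ),
        IsHypergeometricPair a b A B → IsHypergeometricPair a b A' B' →
          ∃ P : (Matrix (Fin n) (Fin n) ℂ)ˣ, A' = P.val * A * P.val⁻¹ ∧ B' = P.val * B * P.val⁻¹

/-- **Irreducibility of hypergeometric groups (Beukers–Heckman 1989, Prop. 3.3 with Prop. 3.2).**
If `(A, B)` is a hypergeometric pair whose parameters satisfy `a_j ≠ b_k` for all `j, k`, then the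
hypergeometric group `⟨A, B⟩ ⊆ GL(n, ℂ)` acts irreducibly on `ℂⁿ`: every subspace `W ⊆ ℂⁿ` stable
under `A` and under `B` (as the linear maps `Matrix.toLin'`) is `⊥` or `⊤`.  This is the direction
quoted by the secondary sources (Fedorov, arXiv:1505.01704, Prop. 2.2: "Combine Prop. 3.2 and
Prop. 3.3 of [BeukersHeckman]"; Filip, arXiv:1609.01170, p. 14: "The hypothesis `a_i ≠ 1/b_j`
guarantees that the flat bundle is irreducible ([BeHe], Proposition 3.3)"); the converse (a common
parameter gives a common eigenvector configuration and a proper stable subspace) is not vendored.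
Discharged below: `BeukersHeckman1989_irreducible_holds`.
[cite: BeukersHeckman1989, Prop. 3.3] [cite: Fedorov2017, Prop. 2.2] -/
def BeukersHeckman1989_irreducible : Prop :=
  ∀ ⦃n : ℕ⦄ (a b : Fin n → ℂ) (A B : Matrix (Fin n) (Fin n) ℂ), IsHypergeometricPair a b A B →
    (∀ j k, a j ≠ b k) →
      ∀ W : Submodule ℂ (Fin n → ℂ),
        W.map (Matrix.toLin' A) ≤ W → W.map (Matrix.toLin' B) ≤ W → W = ⊥ ∨ W = ⊤

end HypergeometricPair

/-! ### Discharge of the irreducibility criterion (Prop. 3.3 ⇐), proved from Mathlib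

Proof (folklore; the argument of Beukers–Heckman, Prop. 3.3): let `W` be a proper non-zero subspace
stable under `A` and `B`.  If `A = B` on `W`, an eigenvector of `A|_W` (which exists over `ℂ`) is a
common eigenvector of `A` and `B`, so `A` and `B` have a common eigenvalue.  Otherwise
`(A - B)w₀ ≠ 0` for some `w₀ ∈ W`, so the line `im(A - B)` is spanned by `(A - B)w₀ ∈ W` and
`A ≡ B` modulo `W`; an eigenvalue `μ` of the common induced endomorphism of `ℂⁿ/W ≠ 0` is then an
eigenvalue of `A` and of `B` (descent lemma `hasEigenvalue_of_sub_smul_mem`).  A common eigenvalue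
is a common root of `∏ (X - a_j)` and `∏ (X - b_k)`, i.e. some `a_j = b_k`, contradiction. -/

section IrreducibleProof

open Module Module.End

variable {V : Type*} [AddCommGroup V] [Module ℂ V] [FiniteDimensional ℂ V]

omit [FiniteDimensional ℂ V] in
/-- An eigen-relation `f x = μ • x` with `x ≠ 0` exhibits the eigenvalue `μ`. [folklore] -/
theorem hasEigenvalue_of_apply_eq_smul {f : End ℂ V} {μ : ℂ} {x : V} (hx : x ≠ 0)
    (h : f x = μ • x) : f.HasEigenvalue μ :=
  hasEigenvalue_of_hasEigenvector (hasEigenvector_iff.2 ⟨mem_eigenspace_iff.2 h, hx⟩)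

/-- **Descent of eigenvalues from a quotient.** If `W` is stable under `f`, `v ∉ W` and
`f v - μ • v ∈ W` (i.e. `μ` is an eigenvalue of the endomorphism induced on `V ⧸ W`, with
eigenvector the class of `v`), then `μ` is an eigenvalue of `f`: either `f - μ` has a kernel
vector inside `W`, or it is bijective on `W` and `v - w` is an eigenvector for the `w ∈ W` with
`(f - μ) w = (f - μ) v`. [folklore] -/
theorem hasEigenvalue_of_sub_smul_mem {f : End ℂ V} {W : Submodule ℂ V}
    (hW : ∀ w ∈ W, f w ∈ W) {v : V} (hv : v ∉ W) {μ : ℂ} (hμ : f v - μ • v ∈ W) :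
    f.HasEigenvalue μ := by
  set g : End ℂ V := f - μ • LinearMap.id with hg
  have hgap : ∀ x, g x = f x - μ • x := fun x => rfl
  have hgW : ∀ w ∈ W, g w ∈ W := fun w hw => by
    rw [hgap]
    exact W.sub_mem (hW w hw) (W.smul_mem μ hw)
  by_cases hinj : Function.Injective (g.restrict hgW)
  · have hsurj : Function.Surjective (g.restrict hgW) :=
      LinearMap.injective_iff_surjective.1 hinj
    obtain ⟨⟨w, hw⟩, hgw⟩ := hsurj ⟨g v, by rw [hgap]; exact hμ⟩
    have hgw' : g w = g v := by
      simpa [LinearMap.coe_restrict_apply] using congrArg Subtype.val hgw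
    refine hasEigenvalue_of_apply_eq_smul (x := v - w) (fun h0 => hv ?_) ?_
    · rw [sub_eq_zero.1 h0]
      exact hw
    · have h1 : g (v - w) = 0 := by rw [map_sub, hgw', sub_self]
      rw [hgap] at h1
      exact sub_eq_zero.1 h1
  · rw [injective_iff_map_eq_zero] at hinj
    push Not at hinj
    obtain ⟨⟨w, hw⟩, hgw, hw0⟩ := hinj
    have hgw' : g w = 0 := by
      simpa [LinearMap.coe_restrict_apply] using congrArg Subtype.val hgw
    refine hasEigenvalue_of_apply_eq_smul (x := w) (fun h0 => hw0 (Subtype.ext h0)) ?_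
    rw [hgap] at hgw'
    exact sub_eq_zero.1 hgw'

/-- **Discharge of `BeukersHeckman1989_irreducible`** (Beukers–Heckman 1989, Prop. 3.3, the
direction "no common parameter ⇒ irreducible"), proved from Mathlib by the argument in the
section docstring: a proper non-zero `⟨A, B⟩`-stable subspace produces a common eigenvalue of `A`
and `B`, i.e. a common root of the two characteristic polynomials.
[cite: BeukersHeckman1989, Prop. 3.3] -/
theorem BeukersHeckman1989_irreducible_holds : BeukersHeckman1989_irreducible := by
  intro n a b A B hAB hab W hA hB
  classical
  obtain ⟨-, -, hcA, hcB, hr⟩ := hAB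
  set LA : End ℂ (Fin n → ℂ) := Matrix.toLin' A with hLA
  set LB : End ℂ (Fin n → ℂ) := Matrix.toLin' B with hLB
  have hA' : ∀ w ∈ W, LA w ∈ W := fun w hw => hA (Submodule.mem_map_of_mem hw)
  have hB' : ∀ w ∈ W, LB w ∈ W := fun w hw => hB (Submodule.mem_map_of_mem hw)
  by_contra hW
  push Not at hW
  obtain ⟨hbot, htop⟩ := hW
  -- Step 1: a common eigenvalue of `A` and `B`.
  have key : ∃ μ : ℂ, LA.HasEigenvalue μ ∧ LB.HasEigenvalue μ := by
    by_cases hWU : ∀ w ∈ W, LA w = LB w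
    · haveI : Nontrivial W := Submodule.nontrivial_iff_ne_bot.2 hbot
      obtain ⟨μ, hμ⟩ := exists_eigenvalue (LA.restrict hA')
      obtain ⟨⟨w, hw⟩, hvec⟩ := hμ.exists_hasEigenvector
      have hw0 : w ≠ 0 := fun h => hvec.2 (Subtype.ext h)
      have hAw : LA w = μ • w := by
        simpa [LinearMap.coe_restrict_apply] using congrArg Subtype.val hvec.apply_eq_smul
      refine ⟨μ, hasEigenvalue_of_apply_eq_smul hw0 hAw, hasEigenvalue_of_apply_eq_smul hw0 ?_⟩
      rw [← hWU w hw, hAw]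
    · push Not at hWU
      obtain ⟨w₀, hw₀, hne⟩ := hWU
      have hdW : LA w₀ - LB w₀ ∈ W := W.sub_mem (hA' _ hw₀) (hB' _ hw₀)
      have hd0 : LA w₀ - LB w₀ ≠ 0 := sub_ne_zero.2 hne
      -- the line `im(A - B)` is spanned by `(A - B) w₀ ∈ W`
      have hrange : ∀ v, LA v - LB v ∈ W := by
        have hsub : LA - LB = (A - B).mulVecLin := by
          rw [hLA, hLB, ← map_sub, Matrix.toLin'_apply']
        have h1 : Module.finrank ℂ (LinearMap.range (LA - LB)) = 1 := by
          rw [hsub]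
          exact hr
        have hmem : LA w₀ - LB w₀ ∈ LinearMap.range (LA - LB) := ⟨w₀, rfl⟩
        have hspan := (finrank_eq_one_iff_of_nonzero'
          (⟨_, hmem⟩ : LinearMap.range (LA - LB)) (fun h => hd0 (congrArg Subtype.val h))).1 h1
        intro v
        obtain ⟨c, hc⟩ := hspan ⟨(LA - LB) v, ⟨v, rfl⟩⟩
        have hc' : c • (LA w₀ - LB w₀) = LA v - LB v := by
          simpa using congrArg Subtype.val hc
        rw [← hc']
        exact W.smul_mem c hdW
      -- eigenvalue of the endomorphism induced by `A` (equivalently `B`) on the quotient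
      haveI : Nontrivial ((Fin n → ℂ) ⧸ W) := Submodule.Quotient.nontrivial_iff.2 htop
      have hle : W ≤ W.comap LA := fun w hw => hA' w hw
      obtain ⟨μ, hμ⟩ := exists_eigenvalue (W.mapQ W LA hle)
      obtain ⟨q, hq⟩ := hμ.exists_hasEigenvector
      obtain ⟨v, rfl⟩ := W.mkQ_surjective q
      have hv : v ∉ W := fun h => hq.2 ((Submodule.Quotient.mk_eq_zero W).2 h)
      have hAv : LA v - μ • v ∈ W := by
        have h1 := hq.apply_eq_smul
        rw [Submodule.mkQ_apply, Submodule.mapQ_apply, ← Submodule.Quotient.mk_smul,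
          Submodule.Quotient.eq] at h1
        exact h1
      have hBv : LB v - μ • v ∈ W := by
        have h1 : LB v - μ • v = (LA v - μ • v) - (LA v - LB v) := by abel
        rw [h1]
        exact W.sub_mem hAv (hrange v)
      exact ⟨μ, hasEigenvalue_of_sub_smul_mem hA' hv hAv, hasEigenvalue_of_sub_smul_mem hB' hv hBv⟩
  -- Step 2: a common eigenvalue is a common root of the characteristic polynomials.
  obtain ⟨μ, hμA, hμB⟩ := key
  rw [hasEigenvalue_iff_isRoot_charpoly, hLA, Matrix.charpoly_toLin', hcA,
    Polynomial.isRoot_prod] at hμA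
  rw [hasEigenvalue_iff_isRoot_charpoly, hLB, Matrix.charpoly_toLin', hcB,
    Polynomial.isRoot_prod] at hμB
  obtain ⟨j, -, hj⟩ := hμA
  obtain ⟨k, -, hk⟩ := hμB
  rw [Polynomial.root_X_sub_C] at hj hk
  exact hab j k (hj.trans hk.symm)

end IrreducibleProof

end Literature.AlgebraicGeometry.Motives
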